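import Mathlib
import HarnessLib
import Literature.Analysis.FluidPDE.ClassicalSolution
import Literature.Analysis.FluidPDE.LerayHopf
import Literature.Analysis.FluidPDE.SelfSimilar
import Literature.Analysis.FluidPDE.SelfSimilarLiouville
import Literature.Analysis.FluidPDE.LocalTypeI
import Literature.Analysis.FluidPDE.VectorCalculus
import Literature.Analysis.FluidPDE.SereginSverak2002PressureLowerBound
import Literature.Analysis.FluidPDE.TypeIAncientMild
import Literature.Analysis.FluidPDE.ChaeWolfRemovingDSS
import Literature.Analysis.FluidPDE.ChaeWolfRemovingDSSProofs
import Literature.Analysis.UnboundedOperators.HeatKernel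
import Summits.NavierStokesRegularity.NavierStokesRegularity.Theorems.LocalVelCompTubeDoorLocalPointZoomVelSlices
import Summits.NavierStokesRegularity.NavierStokesRegularity.Theorems.PlaneStrainDoorZoomSpaceTimeDecay
import Summits.NavierStokesRegularity.NavierStokesRegularity.Theorems.LocalSineTubeDoorProfileAlignedWindowRigidityAncient
import Summits.NavierStokesRegularity.NavierStokesRegularity.Theorems.PoloidalWindowDoorPoloidalWindowRigidityStrata
import Summits.NavierStokesRegularity.NavierStokesRegularity.Theorems.PoloidalWindowDoorPoloidalWindowRigidityFlat
import Summits.NavierStokesRegularity.NavierStokesRegularity.Theorems.PoloidalWindowDoorPoloidalWindowRigidityWindow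
import Summits.NavierStokesRegularity.NavierStokesRegularity.Theorems.AdaptedFrequencyTangentFlowTransferAncientPressure
import Summits.NavierStokesRegularity.NavierStokesRegularity.Theorems.TypeIDSSLiouvilleConjecture

/-!
# PeepholeEchoDoorDefs — S23 «PeepholeEchoDoor» (two-time peephole doors), part 1/4

§0 the two-time defect observable through one off-centre similarity window and §1 the door texts (K1 `LocalPointZoomTwoTime`, residues `OffDiagonalResidue` / `AllRatiosResidue` / `EchoResidue` / `EchoResidueDecayAt` / `EchoResidueDecay`, doors `TargetOffDiagonal` / `TargetAllRatios` / `TargetKronecker` / `TargetEcho` / `TargetEchoDecayAt` / `TargetEchoDecay` / `TargetNearOneEcho`, `EchoAssembly`). Statements only.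

Door family of LADDER-NS N0 (local Type-I window doors S20/S21-C/S22/S23); THEOREMS-ONLY landing of the nsreg-p1 design
`run/shared/lean/pub/ns-regularity-ideate/ns-regularity-ideate-p1/r22/Sketch23.lean` (ROUND-22.md). Conditional door
theorems: they EVADE hard core 10661 by hypothesis (T1/T2/T3/T5) or MEET it at the named wall (T4-D); no route, no items
(DIRECTOR-NS standing #32 (2)). WHAT THIS IS NOT: not a regularity claim; not an attack on `TypeIDSSLiouville`.
-/

noncomputable section

set_option linter.dupNamespace false

namespace Summit.NavierStokesRegularity.NavierStokesRegularity.Theorems.PeepholeEchoDoorDefs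

open MeasureTheory Set Function Filter Topology TopologicalSpace Metric
open scoped RealInnerProductSpace NNReal ENNReal Topology Pointwise
open Literature.Analysis Literature.Analysis.FluidPDE
open Summit.NavierStokesRegularity.NavierStokesRegularity.Theorems.LocalSineTubeDoorProfileAlignedWindowRigidityAncient
open Summit.NavierStokesRegularity.NavierStokesRegularity.Theorems.PoloidalWindowDoorPoloidalWindowRigidityStrata
open Summit.NavierStokesRegularity.NavierStokesRegularity.Theorems.PoloidalWindowDoorPoloidalWindowRigidityFlat
open Summit.NavierStokesRegularity.NavierStokesRegularity.Theorems.PoloidalWindowDoorPoloidalWindowRigidityWindow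

/-! ## §0 The observable: the two-time defect through a peephole -/

/-- The **two-time defect** of `u` at the singular candidate `(x₀, T)`, ratio `κ` and rescaling `μ`, read at time `t`
and similarity position `y`: the difference between the scale-normalised velocity `√(T−t)·u(t, x₀ + √(T−t)y)` and the
`μ`-rescaled velocity `μ√(T−t)·u(t', x₀ + μ√(T−t)y)` at the parabolically related time `t' = T − κ(T−t)`.
For `μ = √κ` the second term is the similarity picture at `t'` (`μ√(T−t) = √(T−t')`): an ECHO.  For `μ = 1` it is the
velocity at the same physical points one parabolic step earlier/later: QUASI-STEADINESS. -/
def twoTimeDefect (T : ℝ) (x₀ : EuclideanSpace ℝ (Fin 3)) (u : ℝ → EuclideanSpace ℝ (Fin 3) → EuclideanSpace ℝ (Fin 3))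
    (κ μ t : ℝ) (y : EuclideanSpace ℝ (Fin 3)) : ℝ :=
  ‖Real.sqrt (T - t) • u t (x₀ + Real.sqrt (T - t) • y) -
    (μ * Real.sqrt (T - t)) • u (T - κ * (T - t)) (x₀ + (μ * Real.sqrt (T - t)) • y)‖

/-- **The two-time defect FADES on the window `U`**: `∫_U (two-time defect)(t, y) dy → 0` as `t → T⁻`. -/
def DefectFades (T : ℝ) (x₀ : EuclideanSpace ℝ (Fin 3)) (u : ℝ → EuclideanSpace ℝ (Fin 3) → EuclideanSpace ℝ (Fin 3))
    (κ μ : ℝ) (U : Set (EuclideanSpace ℝ (Fin 3))) : Prop :=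
  Filter.Tendsto (fun t => ∫⁻ y in U, ENNReal.ofReal (twoTimeDefect T x₀ u κ μ t y)) (nhdsWithin T (Set.Iio T)) (nhds 0)

/-- The **two-point symmetry** imprinted on a profile by a faded `(κ, μ)`-defect: `v(s, z) = μ · v(κ s, μ z)` on the
open backward slab. (`μ² = κ`: discrete self-similarity with factor `μ`; `μ = 1`: log-periodicity in time;
`κ = 1`: slice-wise scale invariance.) -/
def HasTwoPointSymmetry (κ μ : ℝ) (v : ℝ → EuclideanSpace ℝ (Fin 3) → EuclideanSpace ℝ (Fin 3)) : Prop :=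
  ∀ s < 0, ∀ z, v s z = μ • v (κ * s) (μ • z)

/-! ## §1 Route texts (fully qualified; binder-free) -/

/-- crux (rank 3) · K1 · THE UNIVERSAL TWO-TIME ZOOM: local (time) Type I at `(x₀,T)` + backward unboundedness ⇒ ONE
door-class profile, backward-singular at the apex, on which EVERY faded two-time defect through ANY open window imprints
its two-point symmetry. (Tree velocity zoom `localPointZoomVelSlices` + Fatou on the window + slice analyticity.) -/
def LocalPointZoomTwoTime : Prop :=
  ∀ (ν T : ℝ), 0 < ν → 0 < T → ∀ (u : ℝ → EuclideanSpace ℝ (Fin 3) → EuclideanSpace ℝ (Fin 3)) (p : ℝ → EuclideanSpace ℝ (Fin 3) → ℝ), Literature.Analysis.FluidPDE.IsClassicalNSSolutionOn (Set.Ico 0 T) ν 0 u p → Literature.Analysis.FluidPDE.IsLerayHopfOn T ν 0 (u 0) u → Literature.Analysis.FluidPDE.HasRapidSpatialDecay (u 0) → ∀ (x₀ : EuclideanSpace ℝ (Fin 3)) (ρ M : ℝ), 0 < ρ → (∀ t ∈ Set.Ico 0 T, T - ρ ^ 2 < t → ∀ x ∈ Metric.ball x₀ ρ, ‖u t x‖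 * Real.sqrt (ν * (T - t)) ≤ M) → ¬ Literature.Analysis.FluidPDE.IsBackwardBoundedAt u T x₀ → ∃ (C : ℝ) (v : ℝ → EuclideanSpace ℝ (Fin 3) → EuclideanSpace ℝ (Fin 3)), Literature.Analysis.FluidPDE.HasTypeITimeDecay C v ∧ ContinuousOn (Function.uncurry v) (Set.Iio (0 : ℝ) ×ˢ Set.univ) ∧ (∀ s t : ℝ, s < t → t < 0 → ∀ x, v t x = Literature.Analysis.UnboundedOperators.heatExtension (v s) (t - s) x - Literature.Analysis.FluidPDE.oseenDuhamel 1 s v v t x) ∧ (∀ t < 0, Literature.Analysis.FluidPDE.VectorCalculus.IsDivFree (v t)) ∧ Literature.Analysis.FluidPDE.IsBackwardSingularPoint v 0 ∧ ∀ (κ μ : ℝ), 0 < κ → 0 < μ → ∀ (U : Set (EuclideanSpace ℝ (Fin 3))), IsOpen U → U.Nonempty → DefectFades T x₀ u κ μ U → HasTwoPointSymmetry κ μ v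

/-- support (rank 9) · OFF-DIAGONAL RESIDUE (PROVED, rate only): a field with the Type-I time rate and a two-point
symmetry `(κ, μ)` with `μ² ≠ κ` vanishes on the slab. -/
def OffDiagonalResidue : Prop :=
  ∀ (κ μ : ℝ), 0 < κ → 0 < μ → μ ^ 2 ≠ κ → ∀ (C : ℝ) (v : ℝ → EuclideanSpace ℝ (Fin 3) → EuclideanSpace ℝ (Fin 3)), Literature.Analysis.FluidPDE.HasTypeITimeDecay C v → HasTwoPointSymmetry κ μ v → ∀ t < 0, ∀ x, v t x = 0

/-- support (rank 9) · DIAGONAL, ALL RATIOS (PROVED, Tsai 1998 in the class): a door-class profile echoing at every ratio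
is backward self-similar, hence not backward-singular. -/
def AllRatiosResidue : Prop :=
  ∀ (C : ℝ) (v : ℝ → EuclideanSpace ℝ (Fin 3) → EuclideanSpace ℝ (Fin 3)), Literature.Analysis.FluidPDE.HasTypeITimeDecay C v → ContinuousOn (Function.uncurry v) (Set.Iio (0 : ℝ) ×ˢ Set.univ) → (∀ s t : ℝ, s < t → t < 0 → ∀ x, v t x = Literature.Analysis.UnboundedOperators.heatExtension (v s) (t - s) x - Literature.Analysis.FluidPDE.oseenDuhamel 1 s v v t x) → (∀ t < 0, Literature.Analysis.FluidPDE.VectorCalculus.IsDivFree (v t)) → (∀ κ : ℝ, 0 < κ → HasTwoPointSymmetry κ (Real.sqrt κ) v) → ¬ Literature.Analysis.FluidPDE.IsBackwardSingularPoint v 0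

/-- crux (rank 2) · K2 · THE ECHO RESIDUE at ONE ratio `κ ∈ (0,1)` (the named wall, transcribed to the door class):
a door-class profile (Type-I time rate, continuous on the open slab, unit-viscosity Oseen–Duhamel, divergence free)
which is discretely self-similar with factor `√κ` is not backward-singular at the apex.  OPEN for every single `κ`
(Bradshaw–Tsai 2017 question 5.1; Chae–Wolf 2017 Thm 1.3 covers ratios near `1` relative to a SPACE–time Type-I
constant only — see `EchoResidueDecay`). -/
def EchoResidue (κ : ℝ) : Prop :=
  ∀ (C : ℝ) (v : ℝ → EuclideanSpace ℝ (Fin 3) → EuclideanSpace ℝ (Fin 3)), Literature.Analysis.FluidPDE.HasTypeITimeDecay C v → ContinuousOn (Function.uncurry v) (Set.Iio (0 : ℝ) ×ˢ Set.univ) → (∀ s t : ℝ, s < t → t < 0 → ∀ x, v t x = Literature.Analysis.UnboundedOperators.heatExtension (v s) (t - s) x - Literature.Analysis.FluidPDE.oseenDuhamel 1 s v v t x) → (∀ t < 0, Literature.Analysis.FluidPDE.VectorCalculus.IsDivFree (v t)) → HasTwoPointSymmetry κ (Real.sqrt κ) v → ¬ Literature.Analysis.FluidPDE.IsBackwardSingularPoint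 v 0

/-- crux (rank 2′) · K2-D · THE ECHO RESIDUE IN THE DECAY CLASS at decay constant `D` (space–time Type-I profiles,
`‖v(s,z)‖ ≤ D/(‖z‖+√(−s))`): IMPLIED by the wall `Literature.Analysis.FluidPDE.TypeIDSSLiouville (√κ)⁻¹`
(`echoResidueDecayAt_of_wall`, PROVED) and PROVED OUTRIGHT for `κ₁(D) < κ < 1` by Chae–Wolf 2017 Thm 1.3
(`echoResidueDecayAt_nearOne`, via the tree theorem `chaeWolf2017_removing_dss_holds`). -/
def EchoResidueDecayAt (D κ : ℝ) : Prop :=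
  ∀ (C : ℝ) (v : ℝ → EuclideanSpace ℝ (Fin 3) → EuclideanSpace ℝ (Fin 3)), Literature.Analysis.FluidPDE.HasTypeITimeDecay C v → Literature.Analysis.FluidPDE.HasTypeIDecay D v → ContinuousOn (Function.uncurry v) (Set.Iio (0 : ℝ) ×ˢ Set.univ) → (∀ s t : ℝ, s < t → t < 0 → ∀ x, v t x = Literature.Analysis.UnboundedOperators.heatExtension (v s) (t - s) x - Literature.Analysis.FluidPDE.oseenDuhamel 1 s v v t x) → (∀ t < 0, Literature.Analysis.FluidPDE.VectorCalculus.IsDivFree (v t)) → HasTwoPointSymmetry κ (Real.sqrt κ) v → ¬ Literature.Analysis.FluidPDE.IsBackwardSingularPoint v 0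

/-- crux (rank 2′) · K2-D for every decay constant. -/
def EchoResidueDecay (κ : ℝ) : Prop :=
  ∀ D : ℝ, EchoResidueDecayAt D κ

/-- target (rank 0) · DOOR T1 «no off-diagonal repetition» (PROVED): local Type I + ONE faded `(κ, μ)`-defect with
`μ² ≠ κ` on ONE open window ⇒ backward bounded.  (`μ = 1`, `κ ≠ 1`: «a Type-I singularity is never quasi-steady through
a peephole»; `κ = 1`, `μ ≠ 1`: «never instantaneously scale-invariant through a peephole».) -/
def TargetOffDiagonal : Prop :=
  ∀ (ν T : ℝ), 0 < ν → 0 < T → ∀ (u : ℝ → EuclideanSpace ℝ (Fin 3) → EuclideanSpace ℝ (Fin 3)) (p : ℝ → EuclideanSpace ℝ (Fin 3) → ℝ), Literature.Analysis.FluidPDE.IsClassicalNSSolutionOn (Set.Ico 0 T) ν 0 u p → Literature.Analysis.FluidPDE.IsLerayHopfOn T ν 0 (u 0) u → Literature.Analysis.FluidPDE.HasRapidSpatialDecay (u 0) → ∀ (x₀ : EuclideanSpace ℝ (Fin 3)) (ρ M : ℝ), 0 < ρ → (∀ t ∈ Set.Ico 0 T, T - ρ ^ 2 < t → ∀ x ∈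 Metric.ball x₀ ρ, ‖u t x‖ * Real.sqrt (ν * (T - t)) ≤ M) → ∀ (κ μ : ℝ), 0 < κ → 0 < μ → μ ^ 2 ≠ κ → ∀ (U : Set (EuclideanSpace ℝ (Fin 3))), IsOpen U → U.Nonempty → DefectFades T x₀ u κ μ U → Literature.Analysis.FluidPDE.IsBackwardBoundedAt u T x₀

/-- target (rank 0) · DOOR T2 «no total echo» (PROVED): local Type I + the similarity picture echoes at EVERY ratio
`κ ∈ (0,1)` (each on its own open window) ⇒ backward bounded. -/
def TargetAllRatios : Prop :=
  ∀ (ν T : ℝ), 0 < ν → 0 < T → ∀ (u : ℝ → EuclideanSpace ℝ (Fin 3) → EuclideanSpace ℝ (Fin 3)) (p : ℝ → EuclideanSpace ℝ (Fin 3) → ℝ), Literature.Analysis.FluidPDE.IsClassicalNSSolutionOn (Set.Ico 0 T) ν 0 u p → Literature.Analysis.FluidPDE.IsLerayHopfOn T ν 0 (u 0) u → Literature.Analysis.FluidPDE.HasRapidSpatialDecay (u 0) → ∀ (x₀ : EuclideanSpace ℝ (Fin 3)) (ρ M : ℝ), 0 < ρ → (∀ t ∈ Set.Ico 0 T, T -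 ρ ^ 2 < t → ∀ x ∈ Metric.ball x₀ ρ, ‖u t x‖ * Real.sqrt (ν * (T - t)) ≤ M) → (∀ κ : ℝ, 0 < κ → κ < 1 → ∃ U : Set (EuclideanSpace ℝ (Fin 3)), IsOpen U ∧ U.Nonempty ∧ DefectFades T x₀ u κ (Real.sqrt κ) U) → Literature.Analysis.FluidPDE.IsBackwardBoundedAt u T x₀

/-- target (rank 0) · DOOR T3 «no two incommensurable echoes» (PROVED, Kronecker): local Type I + echoes at two ratios
`κ₁, κ₂ ∈ (0,1)` with `log κ₁ / log κ₂` irrational ⇒ backward bounded. -/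
def TargetKronecker : Prop :=
  ∀ (ν T : ℝ), 0 < ν → 0 < T → ∀ (u : ℝ → EuclideanSpace ℝ (Fin 3) → EuclideanSpace ℝ (Fin 3)) (p : ℝ → EuclideanSpace ℝ (Fin 3) → ℝ), Literature.Analysis.FluidPDE.IsClassicalNSSolutionOn (Set.Ico 0 T) ν 0 u p → Literature.Analysis.FluidPDE.IsLerayHopfOn T ν 0 (u 0) u → Literature.Analysis.FluidPDE.HasRapidSpatialDecay (u 0) → ∀ (x₀ : EuclideanSpace ℝ (Fin 3)) (ρ M : ℝ), 0 < ρ → (∀ t ∈ Set.Ico 0 T, T - ρ ^ 2 < t → ∀ x ∈ Metric.ball x₀ ρ, ‖u t x‖ * Real.sqrt (ν * (T - t)) ≤ M) → ∀ (κ₁ κ₂ : ℝ), 0 < κ₁ → κ₁ < 1 → 0 < κ₂ → κ₂ < 1 → Irrational (Real.log κ₁ / Real.log κ₂) → ∀ (U₁ U₂ : Set (EuclideanSpace ℝ (Fin 3))), IsOpen U₁ → U₁.Nonempty → IsOpen U₂ → U₂.Nonempty → DefectFades T x₀ u κ₁ (Real.sqrt κ₁) U₁ → DefectFades T x₀ u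 κ₂ (Real.sqrt κ₂) U₂ → Literature.Analysis.FluidPDE.IsBackwardBoundedAt u T x₀

/-- target (rank 0) · DOOR T4 «no single echo» at the ratio `κ` (CONDITIONAL on `EchoResidue κ`): local Type I + an
echo at ONE ratio `κ ∈ (0,1)` on ONE open window ⇒ backward bounded. -/
def TargetEcho (κ : ℝ) : Prop :=
  ∀ (ν T : ℝ), 0 < ν → 0 < T → ∀ (u : ℝ → EuclideanSpace ℝ (Fin 3) → EuclideanSpace ℝ (Fin 3)) (p : ℝ → EuclideanSpace ℝ (Fin 3) → ℝ), Literature.Analysis.FluidPDE.IsClassicalNSSolutionOn (Set.Ico 0 T) ν 0 u p → Literature.Analysis.FluidPDE.IsLerayHopfOn T ν 0 (u 0) u → Literature.Analysis.FluidPDE.HasRapidSpatialDecay (u 0) → ∀ (x₀ : EuclideanSpace ℝ (Fin 3)) (ρ M : ℝ), 0 < ρ → (∀ t ∈ Set.Ico 0 T, T - ρ ^ 2 < t → ∀ x ∈ Metric.ball x₀ ρ, ‖u t x‖ * Real.sqrt (ν * (T - t)) ≤ M) → ∀ (U : Set (EuclideanSpace ℝ (Fin 3))), IsOpen U → U.Nonempty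 → DefectFades T x₀ u κ (Real.sqrt κ) U → Literature.Analysis.FluidPDE.IsBackwardBoundedAt u T x₀

/-- target (rank 0) · DOOR T4-D «no single echo» at ratio `κ`, SPACE–time local Type I with constants `ν`, `M`
(CONDITIONAL on `EchoResidueDecayAt (M/ν) κ`; hence on the wall `TypeIDSSLiouville (√κ)⁻¹`; UNCONDITIONAL for
`κ₁(M/ν) < κ < 1`, door T5). -/
def TargetEchoDecayAt (ν M κ : ℝ) : Prop :=
  ∀ (T : ℝ), 0 < T → ∀ (u : ℝ → EuclideanSpace ℝ (Fin 3) → EuclideanSpace ℝ (Fin 3)) (p : ℝ → EuclideanSpace ℝ (Fin 3) → ℝ), Literature.Analysis.FluidPDE.IsClassicalNSSolutionOn (Set.Ico 0 T) ν 0 u p → Literature.Analysis.FluidPDE.IsLerayHopfOn T ν 0 (u 0) u → Literature.Analysis.FluidPDE.HasRapidSpatialDecay (u 0) → ∀ (x₀ : EuclideanSpace ℝ (Fin 3)) (ρ : ℝ), 0 < ρ → (∀ t ∈ Set.Ico 0 T, T - ρ ^ 2 < t → ∀ x ∈ Metric.ball x₀ ρ, ‖u t x‖ * (‖x - x₀‖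 + Real.sqrt (ν * (T - t))) ≤ M) → ∀ (U : Set (EuclideanSpace ℝ (Fin 3))), IsOpen U → U.Nonempty → DefectFades T x₀ u κ (Real.sqrt κ) U → Literature.Analysis.FluidPDE.IsBackwardBoundedAt u T x₀

/-- target (rank 0) · DOOR T4-D for all constants (CONDITIONAL on `EchoResidueDecay κ`, hence on the wall
`TypeIDSSLiouville (√κ)⁻¹` — `targetEchoDecay_of_wall`). -/
def TargetEchoDecay (κ : ℝ) : Prop :=
  ∀ (ν M : ℝ), 0 < ν → TargetEchoDecayAt ν M κ

/-- target (rank 0) · DOOR T5 «no fine echo» (PROVED, Chae–Wolf 2017 Thm 1.3 through the peephole): for every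
viscosity `ν` and local SPACE–time Type-I constant `M` there is a ratio threshold `κ₁ < 1` such that a singularity
which is locally Type I with constant `M` cannot echo through any peephole at any ratio `κ ∈ (κ₁, 1)`. -/
def TargetNearOneEcho : Prop :=
  ∀ (ν M : ℝ), 0 < ν → ∃ κ₁ : ℝ, κ₁ < 1 ∧ ∀ (κ : ℝ), κ₁ < κ → κ < 1 → TargetEchoDecayAt ν M κ

/-- assembly (rank 1) for the one-ratio door (named `EchoAssembly`: the bare name `Assembly` is reserved for route files). -/
def EchoAssembly (κ : ℝ) : Prop :=
  LocalPointZoomTwoTime → EchoResidue κ → TargetEcho κ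


end Summit.NavierStokesRegularity.NavierStokesRegularity.Theorems.PeepholeEchoDoorDefs

end
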